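import Summits.QuantumFields.YangMills.Theorems.ToronSmallBallOwnAxisShiftBasic
import Summits.QuantumFields.YangMills.Theorems.ToronSmallBallOwnAxisShiftLocal
import HarnessLib

/-!
# The own-axis sheet shift: transverse and time ladders of line holonomies

Support module (`--supports` stmt-QuantumFields-24089, `ToronSmallBall.PeriodicOffCoreStripWindowDeep`; seat ym-dw-p1 g15).  Quaternion bookkeeping
(`q = su2Quat`) for the `x`-line holonomies `P_n(x) = lineHolonomy U 0 n x` of the spatial torus `(ℤ/L)³`:

* `norm_su2Quat_transport_sub_le` — TRANSVERSE LADDER: `‖q(U(x,j) · P_n(x+e_j) · U(x+ne₀,j)⁻¹) − q(P_n(x))‖ ≤ Σ_{m<n} ‖q(U_{x+me₀;0,j}) − 1‖`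
  (transporting an open line across one lattice spacing costs the plaquettes in between, one induction step per plaquette via
  `U(x,j)U(x+e_j,0) = U_{x;0,j}⁻¹ U(x,0) U(x+e₀,j)`); the closed form (`n = L`) and the CONJUGATED form of the plaquette defect
  `‖q(A P(x+e_j) A⁻¹) − q(P(x))‖`, `A = U(x,0)U(x+e₀,j)U(x+e_j,0)⁻¹` (cyclic rotation `P(x+e₀) = U(x,0)⁻¹ P(x) U(x,0)`);
* `norm_su2Quat_lineHolonomy_sub_le` — TIME LADDER: `‖q(P^U_n(x)) − q(P^V_n(x))‖ ≤ Σ_{m<n} ‖q(U(x+me₀,0)) − q(V(x+me₀,0))‖`;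
* uniform forms: a plaquette bound `ε` sums to `Lε`, a link bound `τ` to `Lτ`.

HONEST FRAMING: fixed-lattice identities and triangle inequalities; nothing about infinite volume, the continuum limit or the Clay gap.  No `sorry`,
no new axiom, no new definition.  References: [cite: Luscher1983, §2].
-/

set_option autoImplicit false

noncomputable section

open scoped Quaternion BigOperators
open NormedSpace Function
open Literature.MathematicalPhysics.QuantumLattice (su2Quat su2Quat_ne_zero norm_su2Quat)
open Literature.MathematicalPhysics.QuantumFieldTheory hiding su2Quat_mul
open Literature.MathematicalPhysics.QuantumFieldTheory.Balaban1983to89.T4HaarSU2Translate (su2Quat_mul su2Quat_one)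

namespace Summit.QuantumFields.YangMills.Theorems.FemtoTransferGap.OwnAxis

open ClassShift

variable {L : ℕ}

/-! ## §1 Ladders -/

section Ladder

/-- Quaternion bookkeeping: `‖a b − c d‖ ≤ ‖a − c‖‖b‖ + ‖c‖‖b − d‖`. [folklore] -/
theorem norm_mul_sub_mul_le' (a b c d : ℍ) : ‖a * b - c * d‖ ≤ ‖a - c‖ * ‖b‖ + ‖c‖ * ‖b - d‖ := by
  have : a * b - c * d = (a - c) * b + c * (b - d) := by noncomm_ring
  rw [this]
  exact (norm_add_le _ _).trans (add_le_add (norm_mul_le _ _) (norm_mul_le _ _))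

/-- The plaquette relation `U(x,j) U(x+e_j,0) = U_{x;0,j}⁻¹ U(x,0) U(x+e₀,j)`. [folklore] -/
theorem transverse_step_eq {G : Type*} [Group G] (U : GaugeConfig 3 L G) (x : Site 3 L) (j : Fin 3) :
    U (x, j) * U (x.shift j, 0) = (plaquetteHolonomy U x 0 j)⁻¹ * U (x, 0) * U (x.shift 0, j) := by
  unfold plaquetteHolonomy
  group

/-- The `m`-th site along the `x`-line through `x`: `(· + e₀)^[m] x = x + m e₀`. [folklore] -/
theorem iterate_shift_eq (x : Site 3 L) : ∀ m : ℕ, (fun y : Site 3 L => y.shift 0)^[m] x = x + Pi.single (0 : Fin 3) ((m : ℕ) : ZMod L)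
  | 0 => by simp
  | m + 1 => by
    rw [Function.iterate_succ_apply', iterate_shift_eq x m]
    simp only [Site.shift, add_assoc, ← Pi.single_add, Nat.cast_succ]

/-- The closed line returns to its base point: `(· + e₀)^[L] x = x`. [folklore] -/
theorem iterate_shift_self (x : Site 3 L) : (fun y : Site 3 L => y.shift 0)^[L] x = x := by
  rw [iterate_shift_eq, ZMod.natCast_self, Pi.single_zero, add_zero]

/-- One transverse step of the ladder, as quaternions: `‖q(Q⁻¹ a B) − q(a C)‖ ≤ ‖q Q − 1‖ + ‖q B − q C‖`. [folklore] -/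
theorem norm_su2Quat_step_le (Q a B C : SU2) :
    ‖su2Quat (Q⁻¹ * a * B) - su2Quat (a * C)‖ ≤ ‖su2Quat Q - 1‖ + ‖su2Quat B - su2Quat C‖ := by
  rw [su2Quat_mul, su2Quat_mul, su2Quat_mul]
  have ha : ‖su2Quat a‖ = 1 := norm_su2Quat _
  have hB : ‖su2Quat B‖ = 1 := norm_su2Quat _
  calc ‖su2Quat Q⁻¹ * su2Quat a * su2Quat B - su2Quat a * su2Quat C‖
      ≤ ‖su2Quat Q⁻¹ * su2Quat a - su2Quat a‖ * ‖su2Quat B‖ + ‖su2Quat a‖ * ‖su2Quat B - su2Quat C‖ := norm_mul_sub_mul_le' _ _ _ _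
    _ = ‖su2Quat Q⁻¹ - 1‖ + ‖su2Quat B - su2Quat C‖ := by
        rw [hB, ha, mul_one, one_mul, show su2Quat Q⁻¹ * su2Quat a - su2Quat a = (su2Quat Q⁻¹ - 1) * su2Quat a by noncomm_ring,
          norm_mul, ha, mul_one]
    _ = ‖su2Quat Q - 1‖ + ‖su2Quat B - su2Quat C‖ := by
        -- `‖q(Q⁻¹) − 1‖ = ‖q(Q) − 1‖` (tree: `TwistedTraceScaling.Negative.R45.norm_su2Quat_inv_sub_one`; one line keeps that import out)
        have h := norm_su2Quat_sub_eq (1 : SU2) Q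
        rw [su2Quat_one, one_mul, norm_sub_rev] at h
        rw [← h]

/-- ★ **Transverse ladder**: transporting the open line of length `n` from `x + e_j` back to `x` costs the plaquettes in between:
`‖q(U(x,j) · P_n(x+e_j) · U(x+ne₀,j)⁻¹) − q(P_n(x))‖ ≤ Σ_{m<n} ‖q(U_{x+me₀;0,j}) − 1‖`. [cite: Luscher1983, §2] -/
theorem norm_su2Quat_transport_sub_le (U : GaugeConfig 3 L SU2) (j : Fin 3) (n : ℕ) :
    ∀ x : Site 3 L,
      ‖su2Quat (U (x, j) * lineHolonomy U 0 n (x.shift j) * (U ((fun y : Site 3 L => y.shift 0)^[n] x, j))⁻¹) - su2Quat (lineHolonomy U 0 n x)‖ ≤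
        ∑ m ∈ Finset.range n, ‖su2Quat (plaquetteHolonomy U ((fun y : Site 3 L => y.shift 0)^[m] x) 0 j) - 1‖ := by
  induction n with
  | zero => intro x; simp [lineHolonomy, su2Quat_one]
  | succ n ih =>
    intro x
    rw [Finset.sum_range_succ', Function.iterate_zero_apply]
    simp only [Function.iterate_succ_apply]
    -- `U(x,j) · P_{n+1}(x+e_j) · b⁻¹ = Q⁻¹ · U(x,0) · [U(x+e₀,j) · P_n(x+e₀+e_j) · b⁻¹]`
    have hstep : U (x, j) * lineHolonomy U 0 (n + 1) (x.shift j) * (U ((fun y : Site 3 L => y.shift 0)^[n] (x.shift 0), j))⁻¹ =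
        (plaquetteHolonomy U x 0 j)⁻¹ * U (x, 0) *
          (U (x.shift 0, j) * lineHolonomy U 0 n ((x.shift 0).shift j) * (U ((fun y : Site 3 L => y.shift 0)^[n] (x.shift 0), j))⁻¹) := by
      -- `(x + e_j) + e₀ = (x + e₀) + e_j` (tree: `TwoLattice.Stiff.shift_shift_comm`)
      have hsc : (x.shift j).shift 0 = (x.shift 0).shift j := by simp only [Site.shift]; abel
      rw [lineHolonomy, hsc, ← mul_assoc (U (x, j)), transverse_step_eq]
      simp only [mul_assoc]
    rw [hstep, lineHolonomy, add_comm]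
    exact (norm_su2Quat_step_le _ _ _ _).trans (add_le_add le_rfl (ih (x.shift 0)))

variable [NeZero L]

omit [NeZero L] in
/-- **Closed ladder** (`n = L`, the line closes up): `‖q(U(x,j) P(x+e_j) U(x,j)⁻¹) − q(P(x))‖ ≤ Σ_{m<L} ‖q(U_{x+me₀;0,j}) − 1‖`. [cite: Luscher1983, §2] -/
theorem norm_su2Quat_transport_closed_sub_le (U : GaugeConfig 3 L SU2) (j : Fin 3) (x : Site 3 L) :
    ‖su2Quat (U (x, j) * lineHolonomy U 0 L (x.shift j) * (U (x, j))⁻¹) - su2Quat (lineHolonomy U 0 L x)‖ ≤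
      ∑ m ∈ Finset.range L, ‖su2Quat (plaquetteHolonomy U ((fun y : Site 3 L => y.shift 0)^[m] x) 0 j) - 1‖ := by
  have h := norm_su2Quat_transport_sub_le U j L x
  rwa [iterate_shift_self] at h

omit [NeZero L] in
/-- A uniform plaquette bound sums to `L ε` along a ladder. [folklore] -/
theorem ladder_sum_le {U : GaugeConfig 3 L SU2} {ε : ℝ} (hP : ∀ (y : Site 3 L) (i j : Fin 3), ‖su2Quat (plaquetteHolonomy U y i j) - 1‖ ≤ ε)
    (j : Fin 3) (x : Site 3 L) :
    ∑ m ∈ Finset.range L, ‖su2Quat (plaquetteHolonomy U ((fun y : Site 3 L => y.shift 0)^[m] x) 0 j) - 1‖ ≤ L * ε :=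
  (Finset.sum_le_card_nsmul _ _ _ fun m _ => hP _ _ _).trans (by simp)

/-- **Cyclic rotation of a closed line**: `P(x + e₀) = U(x,0)⁻¹ · P(x) · U(x,0)`. [folklore] -/
theorem lineHolonomy_shift_eq_conj {G : Type*} [Group G] (U : GaugeConfig 3 L G) (x : Site 3 L) :
    lineHolonomy U 0 L (x.shift 0) = (U (x, 0))⁻¹ * lineHolonomy U 0 L x * U (x, 0) := by
  rw [lineHolonomy_eq_mul_rest U x]
  have h1 : lineHolonomy U 0 L (x.shift 0) = lineHolonomy U 0 (L - 1) (x.shift 0) * U (x, 0) := by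
    have h := WilsonLoopRP.lineHolonomy_succ_right U 0 (L - 1) (x.shift 0)
    rw [WilsonLoopRP.shift_add_single, show L - 1 + 1 = L from Nat.succ_pred_eq_of_pos (NeZero.pos L), ZMod.natCast_self,
      Pi.single_zero, add_zero] at h
    exact h
  rw [h1]
  group

/-- ★ **The conjugated ladder of the plaquette defect**: with `A = U(x,0)U(x+e₀,j)U(x+e_j,0)⁻¹`,
`‖q(A P(x+e_j) A⁻¹) − q(P(x))‖ ≤ Σ_{m<L} ‖q(U_{x+e₀+me₀;0,j}) − 1‖`. [cite: Luscher1983, §2] -/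
theorem norm_su2Quat_conjA_sub_le (U : GaugeConfig 3 L SU2) (j : Fin 3) (x : Site 3 L) :
    ‖su2Quat ((U (x, 0) * U (x.shift 0, j) * (U (x.shift j, 0))⁻¹) * lineHolonomy U 0 L (x.shift j) * (U (x, 0) * U (x.shift 0, j) * (U (x.shift j, 0))⁻¹)⁻¹) -
        su2Quat (lineHolonomy U 0 L x)‖ ≤
      ∑ m ∈ Finset.range L, ‖su2Quat (plaquetteHolonomy U ((fun y : Site 3 L => y.shift 0)^[m] (x.shift 0)) 0 j) - 1‖ := by
  have hrot : (U (x.shift j, 0))⁻¹ * lineHolonomy U 0 L (x.shift j) * U (x.shift j, 0) = lineHolonomy U 0 L ((x.shift 0).shift j) := by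
    have hsc : (x.shift 0).shift j = (x.shift j).shift 0 := by simp only [Site.shift]; abel
    rw [hsc, lineHolonomy_shift_eq_conj]
  have hx : lineHolonomy U 0 L x = U (x, 0) * lineHolonomy U 0 L (x.shift 0) * (U (x, 0))⁻¹ := by
    rw [lineHolonomy_shift_eq_conj]; group
  have hA : (U (x, 0) * U (x.shift 0, j) * (U (x.shift j, 0))⁻¹) * lineHolonomy U 0 L (x.shift j) * (U (x, 0) * U (x.shift 0, j) * (U (x.shift j, 0))⁻¹)⁻¹ =
      U (x, 0) * (U (x.shift 0, j) * lineHolonomy U 0 L ((x.shift 0).shift j) * (U (x.shift 0, j))⁻¹) * (U (x, 0))⁻¹ := by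
    rw [← hrot]; group
  rw [hA, hx, su2Quat_mul, su2Quat_mul, su2Quat_mul (U (x, 0) * lineHolonomy U 0 L (x.shift 0)), su2Quat_mul (U (x, 0)), su2Quat_inv]
  set a := su2Quat (U (x, 0))
  set B := su2Quat (U (x.shift 0, j) * lineHolonomy U 0 L ((x.shift 0).shift j) * (U (x.shift 0, j))⁻¹)
  set C := su2Quat (lineHolonomy U 0 L (x.shift 0))
  have hfac : a * B * a⁻¹ - a * C * a⁻¹ = a * (B - C) * a⁻¹ := by noncomm_ring
  rw [hfac, norm_mul, norm_mul, norm_inv, norm_su2Quat, one_mul, inv_one, mul_one]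
  exact norm_su2Quat_transport_closed_sub_le U j (x.shift 0)

omit [NeZero L] in
/-- ★ **Time ladder**: `‖q(P^U_n(x)) − q(P^V_n(x))‖ ≤ Σ_{m<n} ‖q(U(x+me₀,0)) − q(V(x+me₀,0))‖`. [folklore] -/
theorem norm_su2Quat_lineHolonomy_sub_le (U V : GaugeConfig 3 L SU2) (n : ℕ) :
    ∀ x : Site 3 L, ‖su2Quat (lineHolonomy U 0 n x) - su2Quat (lineHolonomy V 0 n x)‖ ≤
      ∑ m ∈ Finset.range n, ‖su2Quat (U ((fun y : Site 3 L => y.shift 0)^[m] x, 0)) - su2Quat (V ((fun y : Site 3 L => y.shift 0)^[m] x, 0))‖ := by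
  induction n with
  | zero => intro x; simp [lineHolonomy]
  | succ n ih =>
    intro x
    rw [Finset.sum_range_succ', Function.iterate_zero_apply]
    simp only [Function.iterate_succ_apply]
    rw [lineHolonomy, lineHolonomy, su2Quat_mul, su2Quat_mul]
    refine (norm_mul_sub_mul_le' _ _ _ _).trans ?_
    rw [norm_su2Quat, norm_su2Quat, mul_one, one_mul, add_comm]
    exact add_le_add (ih (x.shift 0)) le_rfl

omit [NeZero L] in
/-- A uniform link bound sums to `L τ` along a line. [folklore] -/
theorem norm_su2Quat_lineHolonomy_sub_le_mul {U V : GaugeConfig 3 L SU2} {τ : ℝ} (hT : ∀ e : Edge 3 L, ‖su2Quat (U e) - su2Quat (V e)‖ ≤ τ) (x : Site 3 L) :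
    ‖su2Quat (lineHolonomy U 0 L x) - su2Quat (lineHolonomy V 0 L x)‖ ≤ L * τ :=
  (norm_su2Quat_lineHolonomy_sub_le U V L x).trans ((Finset.sum_le_card_nsmul _ _ _ fun m _ => hT _).trans (by simp))

end Ladder

end Summit.QuantumFields.YangMills.Theorems.FemtoTransferGap.OwnAxis

end
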